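import Literature.AlgebraicGeometry.Frobenioids.ArchimedeanFrobenioidStatements
import HarnessLib

/-!
# Frobenioids II, Example 3.3 (iv): `C`, `A`, `N`, `R` are RC-connected when `D` is — PROOF

Mochizuki, *The geometry of Frobenioids II: poly-Frobenioids*, Kyushu J. Math. **62** (2008)
401–460, §3, Example 3.3 (iv), author's text p. 29 [cite: MochizukiFrdII2008, Ex 3.3 (iv) p.29]:
"If `D` is RC-connected, then the categories `C^Λ`, `A`, `N`, `R` are also RC-connected [cf.
Definition 3.1, (v)]".

PROVED here for `C` (`Λ = ℤ`), `A`, `N`, `R` (`Ex33iv_rcConnected_holds`), by LIFTING ZIGZAGS: over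
every `d ∈ Ob(D)` sits the standard isotropic object of tip `1` (in `R`: rigidified by its canonical
arrow to the real unit object); every arrow `u` of `D` lifts to the arrow `(π(u), 1, 1)` between
standard objects; and every object `X` maps to the standard object over its own base point by the
linear isometry `(ι_X, 1, 1/tip(A_X))`. Hence zigzags of `D` (resp. of `D[ℝ]`, `D[ℂ]`) lift to zigzags
of `C`, `A`, `N`, `R` (resp. of their real / complex parts), through a generic lifting lemma
(`isConnected_of_std`, `part_of_std`).
-/

namespace Literature.AlgebraicGeometry.Frobenioids

open CategoryTheory
open scoped Pointwise

noncomputable section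

namespace ArchFrd

/-! ### Generic zigzag lifting along a functor with standard objects -/

section Lift

universe v₁ u₁ v₂ u₂

variable {E : Type u₁} [Category.{v₁} E] {B : Type u₂} [Category.{v₂} B]

/-- Zigzags of the base lift to zigzags of standard objects. [cite: MochizukiFrdII2008, Ex 3.3 (iv) p.29] -/
theorem zigzag_std (std : B → E) (lift : ∀ ⦃d₁ d₂ : B⦄ (_ : d₁ ⟶ d₂), Nonempty (std d₁ ⟶ std d₂))
    {d₁ d₂ : B} (h : Zigzag d₁ d₂) : Zigzag (std d₁) (std d₂) := by
  induction h with
  | refl => exact Relation.ReflTransGen.refl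
  | tail _ hz ih =>
    refine ih.trans ?_
    rcases hz with ⟨⟨u⟩⟩ | ⟨⟨u⟩⟩
    · exact Zigzag.of_hom (lift u).some
    · exact Zigzag.of_inv (lift u).some

/-- A category with standard objects over a connected base is connected.
[cite: MochizukiFrdII2008, Ex 3.3 (iv) p.29] -/
theorem isConnected_of_std (G : E ⥤ B) (std : B → E)
    (lift : ∀ ⦃d₁ d₂ : B⦄ (_ : d₁ ⟶ d₂), Nonempty (std d₁ ⟶ std d₂))
    (conn : ∀ X : E, Nonempty (X ⟶ std (G.obj X))) (hB : IsConnected B) : IsConnected E := by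
  haveI := hB.is_nonempty
  haveI : Nonempty E := ⟨std (Classical.arbitrary B)⟩
  refine zigzag_isConnected fun X Y => ?_
  exact (Zigzag.of_hom (conn X).some).trans
    ((zigzag_std std lift (isPreconnected_zigzag (G.obj X) (G.obj Y))).trans
      (Zigzag.of_inv (conn Y).some))

/-- The standard object over an object of the part `B_p`, as an object of the `(p ∘ G)`-part of `E`.
[cite: MochizukiFrdII2008, Ex 3.3 (iv) p.29] -/
def stdP (G : E ⥤ B) (std : B → E) (hstd : ∀ d, G.obj (std d) = d) (p : ObjectProperty B)
    (d : p.FullSubcategory) : ObjectProperty.FullSubcategory (fun X : E => p (G.obj X)) :=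
  ⟨std d.obj, by rw [hstd]; exact d.property⟩

/-- Zigzags of `B_p` lift to zigzags of `E_p`. [cite: MochizukiFrdII2008, Ex 3.3 (iv) p.29] -/
theorem zigzag_stdP (G : E ⥤ B) (std : B → E) (hstd : ∀ d, G.obj (std d) = d)
    (lift : ∀ ⦃d₁ d₂ : B⦄ (_ : d₁ ⟶ d₂), Nonempty (std d₁ ⟶ std d₂)) (p : ObjectProperty B)
    {d₁ d₂ : p.FullSubcategory} (h : Zigzag d₁ d₂) :
    Zigzag (stdP G std hstd p d₁) (stdP G std hstd p d₂) := by
  induction h with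
  | refl => exact Relation.ReflTransGen.refl
  | tail _ hz ih =>
    refine ih.trans ?_
    rcases hz with ⟨⟨u⟩⟩ | ⟨⟨u⟩⟩
    · exact Zigzag.of_hom (InducedCategory.homMk (lift u.hom).some)
    · exact Zigzag.of_inv (InducedCategory.homMk (lift u.hom).some)

/-- The `(p ∘ G)`-part of `E` is empty or connected when the `p`-part of `B` is.
[cite: MochizukiFrdII2008, Ex 3.3 (iv) p.29] -/
theorem part_of_std (G : E ⥤ B) (std : B → E) (hstd : ∀ d, G.obj (std d) = d)
    (lift : ∀ ⦃d₁ d₂ : B⦄ (_ : d₁ ⟶ d₂), Nonempty (std d₁ ⟶ std d₂))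
    (conn : ∀ X : E, Nonempty (X ⟶ std (G.obj X))) (p : ObjectProperty B)
    (hp : IsEmpty p.FullSubcategory ∨ IsConnected p.FullSubcategory) :
    IsEmpty (ObjectProperty.FullSubcategory (fun X : E => p (G.obj X))) ∨
      IsConnected (ObjectProperty.FullSubcategory (fun X : E => p (G.obj X))) := by
  rcases hp with he | hc
  · exact Or.inl ⟨fun X => he.false ⟨G.obj X.obj, X.property⟩⟩
  · right
    obtain ⟨d₀⟩ := hc.is_nonempty
    haveI : Nonempty (ObjectProperty.FullSubcategory (fun X : E => p (G.obj X))) :=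
      ⟨stdP G std hstd p d₀⟩
    refine zigzag_isConnected fun X Y => ?_
    have hz := isPreconnected_zigzag (⟨G.obj X.obj, X.property⟩ : p.FullSubcategory)
      ⟨G.obj Y.obj, Y.property⟩
    have hX : Zigzag X (stdP G std hstd p ⟨G.obj X.obj, X.property⟩) :=
      Zigzag.of_hom (InducedCategory.homMk (conn X.obj).some)
    have hY : Zigzag (stdP G std hstd p ⟨G.obj Y.obj, Y.property⟩) Y :=
      Zigzag.of_inv (InducedCategory.homMk (conn Y.obj).some)
    exact hX.trans ((zigzag_stdP G std hstd lift p hz).trans hY)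

end Lift

/-! ### Standard isotropic objects of `C₀` and the arrows into them -/

namespace C0

/-- The isotropic object of `C₀` over `K` with tip `t`. [cite: MochizukiFrdII2008, Ex 3.3 (iv) p.29] -/
def isoObj (K : D0) (t : PosReal) : C0 :=
  ⟨K, AngularRegion.isotropicOfTip t, fun _ => AngularRegion.isIsotropic_isotropicOfTip t⟩

/-- The arrow `(b, 1, c) : X → (K, disc of radius t)` for any base arrow `b : K_X → K` and any scalar
`c` of `K_X` with `|c| · tip(A_X) ≤ t`. [cite: MochizukiFrdII2008, Ex 3.3 (iv) p.29] -/
def homToIso {X : C0} {K : D0} (b : X.base ⟶ K) (t : PosReal) (c : ℂˣ) (hc : c ∈ D0.scalars X.base)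
    (hle : ‖(c : ℂ)‖ * X.tip ≤ t) : X ⟶ isoObj K t where
  base := b
  degFr := 1
  scalar := c
  scalar_mem := hc
  mapsTo := by
    have hiso : (isoObj K t).region.IsIsotropic := AngularRegion.isIsotropic_isotropicOfTip t
    rintro _ ⟨u, hu, rfl⟩
    rw [PNat.one_coe, pow_one] at hu
    change c • u ∈ D0.galAct (D0.Hom.twists b) '' (isoObj K t).region.carrier
    rw [image_galAct_of_isIsotropic hiso, mem_carrier_of_isIsotropic hiso, ← Subtype.coe_le_coe,
      coe_absHom]
    change ‖((c * u : ℂˣ) : ℂ)‖ ≤ (t : ℝ)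
    have hu' : ‖(u : ℂ)‖ ≤ X.tip := by
      have := hu.2
      rw [← Subtype.coe_le_coe, coe_absHom] at this
      exact this
    rw [Units.val_mul, norm_mul]
    exact (mul_le_mul_of_nonneg_left hu' (norm_nonneg _)).trans hle

/-- `homToIso` is an isometry when `|c| · tip(A_X) = t`. [cite: MochizukiFrdII2008, Ex 3.3 (iv) p.29] -/
theorem isIsometry_homToIso {X : C0} {K : D0} (b : X.base ⟶ K) (t : PosReal) (c : ℂˣ)
    (hc : c ∈ D0.scalars X.base) (heq : ‖(c : ℂ)‖ * X.tip = t) :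
    PreFrobenioid.IsIsometry C0.toElem (homToIso b t c hc heq.le) := by
  refine (A0.isIsometry_iff_norm_mul_tip_pow _).mpr ?_
  change ‖(c : ℂ)‖ * X.tip ^ ((1 : ℕ+) : ℕ) = (t : ℝ)
  rw [PNat.one_coe, pow_one, heq]

/-- The inverse tip `1 / tip(A_X)` as a scalar: `|tip⁻¹| · tip = 1`.
[cite: MochizukiFrdII2008, Ex 3.3 (iv) p.29] -/
theorem norm_invTip_mul (X : C0) :
    ‖(((ofPosReal ℂ X.region.tip)⁻¹ : ℂˣ) : ℂ)‖ * X.tip = ((1 : PosReal) : ℝ) := by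
  rw [Units.val_inv_eq_inv_val, norm_inv, coe_ofPosReal, RCLike.norm_ofReal,
    abs_of_pos X.region.tip.2]
  change (X.tip)⁻¹ * X.tip = (1 : ℝ)
  exact inv_mul_cancel₀ X.tip_pos.ne'

/-- `|1| · 1 = 1`. [cite: MochizukiFrdII2008, Ex 3.3 (iv) p.29] -/
theorem norm_one_mul_tip_isoObj (K : D0) :
    ‖((1 : ℂˣ) : ℂ)‖ * (isoObj K 1).tip = ((1 : PosReal) : ℝ) := by
  rw [Units.val_one, norm_one, one_mul]; rfl

end C0

universe v u

variable {D : Type u} [Category.{v} D] (π : D ⥤ D0)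

/-! ### Standard objects and lifted arrows in `C` -/

namespace C

/-- The standard object of `C` over `d`: `(π(d), unit disc)` with the identity identification.
[cite: MochizukiFrdII2008, Ex 3.3 (iv) p.29] -/
def std (d : D) : C π := ⟨C0.isoObj (π.obj d) 1, d, Iso.refl _⟩

/-- The lift `(π(u), 1, 1)` of an arrow `u` of `D`. [cite: MochizukiFrdII2008, Ex 3.3 (iv) p.29] -/
def stdMap {d₁ d₂ : D} (u : d₁ ⟶ d₂) : std π d₁ ⟶ std π d₂ :=
  ⟨C0.homToIso (π.map u) 1 1 (one_mem _) (C0.norm_one_mul_tip_isoObj (π.obj d₁)).le, u, by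
    change π.map u ≫ 𝟙 _ = 𝟙 _ ≫ π.map u
    rw [Category.comp_id, Category.id_comp]⟩

/-- The arrow `(ι_X, 1, 1/tip) : X → std(base of X)`. [cite: MochizukiFrdII2008, Ex 3.3 (iv) p.29] -/
def toStd (X : C π) : X ⟶ std π X.snd :=
  ⟨C0.homToIso X.iso.hom 1 _ (inv_mem (ofPosReal_mem_scalars _ _)) (C0.norm_invTip_mul X.fst).le,
    𝟙 X.snd, by
    change X.iso.hom ≫ 𝟙 _ = X.iso.hom ≫ π.map (𝟙 X.snd)
    rw [CategoryTheory.Functor.map_id]⟩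

/-- `stdMap` is an isometry. [cite: MochizukiFrdII2008, Ex 3.3 (iv) p.29] -/
theorem isIsometry_stdMap {d₁ d₂ : D} (u : d₁ ⟶ d₂) :
    PreFrobenioid.IsIsometry (C.toElem π) (stdMap π u) :=
  C0.isIsometry_homToIso _ _ _ _ (C0.norm_one_mul_tip_isoObj (π.obj d₁))

/-- `toStd` is an isometry. [cite: MochizukiFrdII2008, Ex 3.3 (iv) p.29] -/
theorem isIsometry_toStd (X : C π) : PreFrobenioid.IsIsometry (C.toElem π) (toStd π X) :=
  C0.isIsometry_homToIso _ _ _ _ (C0.norm_invTip_mul X.fst)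

/-- `C` is RC-connected when `D` is. [cite: MochizukiFrdII2008, Ex 3.3 (iv) p.29] -/
theorem isRCConnected (h : RC.IsRCConnected (π ⋙ D0.toArchBase)) :
    RC.IsRCConnected (C.toBase π ⋙ π ⋙ D0.toArchBase) where
  isConnected := isConnected_of_std (C.toBase π) (std π) (fun _ _ u => ⟨stdMap π u⟩)
    (fun X => ⟨toStd π X⟩) h.isConnected
  real := part_of_std (C.toBase π) (std π) (fun _ => rfl) (fun _ _ u => ⟨stdMap π u⟩)
    (fun X => ⟨toStd π X⟩) (RC.realObjects (π ⋙ D0.toArchBase)) h.real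
  complex := part_of_std (C.toBase π) (std π) (fun _ => rfl) (fun _ _ u => ⟨stdMap π u⟩)
    (fun X => ⟨toStd π X⟩) (RC.complexObjects (π ⋙ D0.toArchBase)) h.complex

end C

/-! ### `A` and `N`: the same objects and arrows (linear isometries) -/

namespace A

/-- The standard object of `A` over `d`. [cite: MochizukiFrdII2008, Ex 3.3 (iv) p.29] -/
def std (d : D) : A π := ⟨C.std π d⟩

/-- The lift of `u` to `A` (an isometry). [cite: MochizukiFrdII2008, Ex 3.3 (iv) p.29] -/
def stdMap {d₁ d₂ : D} (u : d₁ ⟶ d₂) : std π d₁ ⟶ std π d₂ :=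
  ⟨C.stdMap π u, C.isIsometry_stdMap π u⟩

/-- `X → std`, in `A`. [cite: MochizukiFrdII2008, Ex 3.3 (iv) p.29] -/
def toStd (X : A π) : X ⟶ std π X.obj.snd := ⟨C.toStd π X.obj, C.isIsometry_toStd π X.obj⟩

/-- `A` is RC-connected when `D` is. [cite: MochizukiFrdII2008, Ex 3.3 (iv) p.29] -/
theorem isRCConnected (h : RC.IsRCConnected (π ⋙ D0.toArchBase)) :
    RC.IsRCConnected (A.toBase π ⋙ π ⋙ D0.toArchBase) where
  isConnected := isConnected_of_std (A.toBase π) (std π) (fun _ _ u => ⟨stdMap π u⟩)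
    (fun X => ⟨toStd π X⟩) h.isConnected
  real := part_of_std (A.toBase π) (std π) (fun _ => rfl) (fun _ _ u => ⟨stdMap π u⟩)
    (fun X => ⟨toStd π X⟩) (RC.realObjects (π ⋙ D0.toArchBase)) h.real
  complex := part_of_std (A.toBase π) (std π) (fun _ => rfl) (fun _ _ u => ⟨stdMap π u⟩)
    (fun X => ⟨toStd π X⟩) (RC.complexObjects (π ⋙ D0.toArchBase)) h.complex

end A

namespace N

/-- The standard object of `N` over `d`. [cite: MochizukiFrdII2008, Ex 3.3 (iv) p.29] -/
def std (d : D) : N π := ⟨A.std π d⟩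

/-- The lift of `u` to `N` (linear). [cite: MochizukiFrdII2008, Ex 3.3 (iv) p.29] -/
def stdMap {d₁ d₂ : D} (u : d₁ ⟶ d₂) : std π d₁ ⟶ std π d₂ := ⟨A.stdMap π u, rfl⟩

/-- `X → std`, in `N`. [cite: MochizukiFrdII2008, Ex 3.3 (iv) p.29] -/
def toStd (X : N π) : X ⟶ std π X.obj.obj.snd := ⟨A.toStd π X.obj, rfl⟩

/-- `N` is RC-connected when `D` is. [cite: MochizukiFrdII2008, Ex 3.3 (iv) p.29] -/
theorem isRCConnected (h : RC.IsRCConnected (π ⋙ D0.toArchBase)) :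
    RC.IsRCConnected (N.toBase π ⋙ π ⋙ D0.toArchBase) where
  isConnected := isConnected_of_std (N.toBase π) (std π) (fun _ _ u => ⟨stdMap π u⟩)
    (fun X => ⟨toStd π X⟩) h.isConnected
  real := part_of_std (N.toBase π) (std π) (fun _ => rfl) (fun _ _ u => ⟨stdMap π u⟩)
    (fun X => ⟨toStd π X⟩) (RC.realObjects (π ⋙ D0.toArchBase)) h.real
  complex := part_of_std (N.toBase π) (std π) (fun _ => rfl) (fun _ _ u => ⟨stdMap π u⟩)
    (fun X => ⟨toStd π X⟩) (RC.complexObjects (π ⋙ D0.toArchBase)) h.complex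

end N

/-! ### `R = R₀ ×_{D₀} D`: standard objects rigidified by their arrow to the real unit object -/

namespace C0

/-- The canonical arrow `(K → Spec ℝ, 1, 1)` from the unit disc over `K` to the real unit object.
[cite: MochizukiFrdII2008, Ex 3.3 (iv) p.29] -/
def isoObjToUnit (K : D0) : isoObj K 1 ⟶ realOfTip 1 :=
  homToIso (D0.homToReal K) 1 1 (one_mem _) (norm_one_mul_tip_isoObj K).le

/-- `isoObjToUnit` is an isometry. [cite: MochizukiFrdII2008, Ex 3.3 (iv) p.29] -/
theorem isIsometry_isoObjToUnit (K : D0) : PreFrobenioid.IsIsometry C0.toElem (isoObjToUnit K) :=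
  isIsometry_homToIso _ _ _ _ (norm_one_mul_tip_isoObj K)

end C0

namespace R

/-- The standard object of `N₀` over `K` (unit disc). [cite: MochizukiFrdII2008, Ex 3.3 (iv) p.29] -/
def stdN0 (K : D0) : N0 := ⟨⟨C0.isoObj K 1⟩⟩

/-- Its rigidification: the arrow to the real unit object, in `N₀`. [cite: MochizukiFrdII2008, Ex 3.3 (iv) p.29] -/
def stdUnit (K : D0) : stdN0 K ⟶ N0.realUnit :=
  N0.homMk (C0.isoObjToUnit K) (C0.isIsometry_isoObjToUnit K) rfl

/-- The standard object of `R₀ = (N₀)_{A_ℝ}` over `K`. [cite: MochizukiFrdII2008, Ex 3.3 (iv) p.29] -/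
def stdR0 (K : D0) : R0 := Over.mk (stdUnit K)

/-- The standard object of `R` over `d`. [cite: MochizukiFrdII2008, Ex 3.3 (iv) p.29] -/
def std (d : D) : R π := ⟨stdR0 (π.obj d), d, Iso.refl _⟩

/-- The `N₀`-arrow between unit discs over a base arrow `b`, scalar `1`.
[cite: MochizukiFrdII2008, Ex 3.3 (iv) p.29] -/
def stdN0Map {K L : D0} (b : K ⟶ L) : stdN0 K ⟶ stdN0 L :=
  N0.homMk (C0.homToIso (X := C0.isoObj K 1) b 1 1 (one_mem _) (C0.norm_one_mul_tip_isoObj K).le)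
    (C0.isIsometry_homToIso _ _ _ _ (C0.norm_one_mul_tip_isoObj K)) rfl

/-- `stdN0Map` commutes with the rigidifications. [cite: MochizukiFrdII2008, Ex 3.3 (iv) p.29] -/
theorem stdN0Map_comp_stdUnit {K L : D0} (b : K ⟶ L) :
    stdN0Map b ≫ stdUnit L = stdUnit K := by
  apply N0.hom_ext
  rw [N0.homCarrier_comp]
  refine C0.hom_ext (@Subsingleton.elim _ (D0.subsingleton_hom_to_real _) _ _) rfl ?_
  rw [C0.scalar_comp']
  change (C0.Base _).act (1 : ℂˣ) * (1 : ℂˣ) ^ ((1 : ℕ+) : ℕ) = (1 : ℂˣ)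
  rw [map_one, one_pow, mul_one]

/-- The lift of `u` to `R`. [cite: MochizukiFrdII2008, Ex 3.3 (iv) p.29] -/
def stdMap {d₁ d₂ : D} (u : d₁ ⟶ d₂) : std π d₁ ⟶ std π d₂ :=
  ⟨Over.homMk (stdN0Map (π.map u)) (stdN0Map_comp_stdUnit (π.map u)), u, by
    change π.map u ≫ 𝟙 _ = 𝟙 _ ≫ π.map u
    rw [Category.comp_id, Category.id_comp]⟩

variable {π}

/-- The scalar bound `|c_X| · tip(A_X) = 1` of the rigidification `X → A_ℝ` of an object of `R`
(a linear isometry to the unit real object). [cite: MochizukiFrdII2008, Ex 3.3 (iv) p.29] -/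
theorem norm_scalar_hom_mul_tip (X : R π) :
    ‖(C0.scalar (N0.homCarrier X.fst.hom) : ℂ)‖ * (N0.carrier X.fst.left).tip = ((1 : PosReal) : ℝ) := by
  have hiso := (A0.isIsometry_iff_norm_mul_tip_pow _).mp X.fst.hom.1.2
  have hlin : C0.degFr (N0.homCarrier X.fst.hom) = 1 := X.fst.hom.2
  rw [hlin, PNat.one_coe, pow_one] at hiso
  exact hiso

/-- The `N₀`-arrow `(ι_X, 1, c_X)` from the underlying object of `X ∈ Ob(R)` to the unit disc over its
base point. [cite: MochizukiFrdII2008, Ex 3.3 (iv) p.29] -/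
def toStdN0 (X : R π) : X.fst.left ⟶ stdN0 (π.obj X.snd) :=
  N0.homMk (C0.homToIso (X := N0.carrier X.fst.left) X.iso.hom 1 (C0.scalar (N0.homCarrier X.fst.hom))
      (N0.homCarrier X.fst.hom).scalar_mem (norm_scalar_hom_mul_tip X).le)
    (C0.isIsometry_homToIso _ _ _ _ (norm_scalar_hom_mul_tip X)) rfl

/-- `toStdN0` commutes with the rigidifications. [cite: MochizukiFrdII2008, Ex 3.3 (iv) p.29] -/
theorem toStdN0_comp_stdUnit (X : R π) : toStdN0 X ≫ stdUnit (π.obj X.snd) = X.fst.hom := by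
  apply N0.hom_ext
  rw [N0.homCarrier_comp]
  refine C0.hom_ext (@Subsingleton.elim _ (D0.subsingleton_hom_to_real _) _ _) ?_ ?_
  · rw [C0.degFr_comp']
    change (1 : ℕ+) * 1 = C0.degFr (N0.homCarrier X.fst.hom)
    rw [mul_one]
    exact (X.fst.hom.2 : C0.degFr (N0.homCarrier X.fst.hom) = 1).symm
  · rw [C0.scalar_comp']
    change (C0.Base _).act (1 : ℂˣ) * C0.scalar (N0.homCarrier X.fst.hom) ^ ((1 : ℕ+) : ℕ) =
      C0.scalar (N0.homCarrier X.fst.hom)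
    rw [map_one, one_mul, PNat.one_coe, pow_one]

variable (π)

/-- `X → std`, in `R`. [cite: MochizukiFrdII2008, Ex 3.3 (iv) p.29] -/
def toStd (X : R π) : X ⟶ std π X.snd :=
  ⟨Over.homMk (toStdN0 X) (toStdN0_comp_stdUnit X), 𝟙 X.snd, by
    change X.iso.hom ≫ 𝟙 _ = X.iso.hom ≫ π.map (𝟙 X.snd)
    rw [CategoryTheory.Functor.map_id]⟩

/-- `R` is RC-connected when `D` is. [cite: MochizukiFrdII2008, Ex 3.3 (iv) p.29] -/
theorem isRCConnected (h : RC.IsRCConnected (π ⋙ D0.toArchBase)) :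
    RC.IsRCConnected (R.toBase π ⋙ π ⋙ D0.toArchBase) where
  isConnected := isConnected_of_std (R.toBase π) (std π) (fun _ _ u => ⟨stdMap π u⟩)
    (fun X => ⟨toStd π X⟩) h.isConnected
  real := part_of_std (R.toBase π) (std π) (fun _ => rfl) (fun _ _ u => ⟨stdMap π u⟩)
    (fun X => ⟨toStd π X⟩) (RC.realObjects (π ⋙ D0.toArchBase)) h.real
  complex := part_of_std (R.toBase π) (std π) (fun _ => rfl) (fun _ _ u => ⟨stdMap π u⟩)
    (fun X => ⟨toStd π X⟩) (RC.complexObjects (π ⋙ D0.toArchBase)) h.complex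

end R

/-- **Example 3.3 (iv)**: "If `D` is RC-connected, then `C`, `A`, `N`, `R` are RC-connected" — PROVED
(`C^Λ` for `Λ = ℤ`; the completions `Λ ∈ {ℚ, ℝ}` are interface-only). [cite: MochizukiFrdII2008, Ex 3.3 (iv) p.29] -/
theorem Ex33iv_rcConnected_holds : Ex33iv_rcConnected π := fun h =>
  ⟨C.isRCConnected π h, A.isRCConnected π h, N.isRCConnected π h, R.isRCConnected π h⟩

end ArchFrd

end

end Literature.AlgebraicGeometry.Frobenioids
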